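import Summits.ResolutionOfSingularities.ResolutionOfSingularities.Theorems.FrobeniusClosingPatchingRelPerfectDepthMixedTargetsJR
import Summits.ResolutionOfSingularities.ResolutionOfSingularities.Theorems.FrobeniusClosingPatchingRelPerfectDepthWeightedStepBookkeeping
import Literature.AlgebraicGeometry.Resolution.BlowupSNC
import Literature.AlgebraicGeometry.Resolution.KollarBlowupSequenceFunctors
import HarnessLib

/-!
# Crux `PatchingRelPerfect` (stmt-ResolutionOfSingularities-16161), chain W5.2 — TargetsF5J v5.1 = F5 OF RECORD («JR», p515168)
# E-side generic FEEDER, part 2: bookkeeping ALONG a weighted sequence with boundary and carried reduced host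

[OURS · L1 W5.2 · TargetsF5J support · res-L1-w52-plan-1 g7 AMEND v5.1 + HANDS 2026-08-27T08:22:43Z «res-D-pv-021: TAKE the
E-side generic FEEDER … (i) `map_fst_eq` … (ii) `not_le_boundary` (by cases) … (iii) the MONOMIAL BOOKKEEPING lemma», RULINGS
08:35:38Z (1) «read every J-name as the JR-name; res-D-pv-021 feeder lemmas are `IsWeightedSeqJR.map_fst_eq / .not_le_boundary /
…`»; consumers res-D-pv-054 AS stub-6 (producer of `IsWeightedSeqJR 2` + `EndStateJR`) and res-D-pv-052 AS stub-7 / res-D-pv-009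
(X-side `StepMixedJR` / pockets)]
Pure PROOFS, no definitions, no named facts, over lead-2's `…DepthMixedTargetsJR` (p515168: `DepthTargets.IsWeightedSeqJR`, the
weighted controlled blow-up sequences WITH BOUNDARY EXPONENT LISTS `ℬ_j`, `𝒟_j` AND CARRIED REDUCED HOST `D_j` under the max-weight
policy) and part 1 `…DepthWeightedStepBookkeeping` (p514886, the one-step identity (iii)).  Along ANY sequence
`IsWeightedSeqJR μ ρ 𝔟 D ℬ 𝒟 𝔟' D' ℬ' 𝒟'`:

* (i) **`IsWeightedSeqJR.map_fst_eq`** — if the two exponent lists have the same underlying boundary initially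
  (`𝒟.map Prod.fst = ℬ.map Prod.fst`), they have the same underlying boundary at the end (each step appends the strict transforms
  in order and then the SAME exceptional member `C𝒪` to both lists; only the exponents differ);
* (ii) **`IsWeightedSeqJR.not_le_boundary`** — the carried host never acquires a boundary component: `∀ p ∈ ℬ', ¬ D' ≤ p.1`
  (by cases: the `nil` hypothesis, resp. the two «no boundary component» hypotheses of `cons`);
* (iv) **`IsWeightedSeqJR.isLocallyNoetherian_and_eq`** / `.eq_host_mul_monomialIdeal` / `.isLocallyNoetherian` — over a locally
  Noetherian `E`, the top `E'` is locally Noetherian and **the E-side INVARIANT `𝔟' = D' · monomialIdeal ℬ'` holds at the end**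
  («state = carried host × boundary monomial with the booked exponents»; induction: the `nil` clause, and at each `cons` part 1's
  `controlledTransform_host_mul_monomialIdeal` fed with exactly the `cons` hypotheses `D' ≤ C^m`, `ν ≤ m + w`,
  `HasSNCWith (boundaryOf ℬ') C`, `UniformPieces ℬ' C [V(C)]`, `IsBlowup τ C`) — this is the third conjunct of
  `DepthTargets.EndStateJR 𝔟' D' ℬ'` for free, at every state;
* `boundaryOf_map_strictTransform_append` / `hasSNC_boundaryOf_map_strictTransform_append` — the booked list's boundary is the
  tree's transformed boundary `(boundaryOf ℬ').map st ++ [C𝒪]`, hence snc (`HasSNCWith.hasSNC_transform`); whence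
  **`IsWeightedSeqJR.hasSNC_boundaryOf`** — the boundary of the `ℬ`-list has simple normal crossings at the end if it has initially.

AI-written; AI review is weaker than expert review. Nothing here is a statement of the manuscript under review.

## References
* E. Bierstone, D. Grigoriev, P. Milman, J. Włodarczyk, *Effective Hironaka resolution and its complexity*, Asian J.
  Math. 15 (2011), Def. 3.1.3 (2)/(4), §3.2 Lemma 3.2.1, §4 Step 2a. [BierstoneGrigorievMilmanWlodarczyk2011]
* J. Kollár, *Lectures on Resolution of Singularities* (2007), Def. 3.25, (3.111) Steps 1–3. [Kollar2007]
-/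

-- `Summit.<Summit>.<Sub>.Theorems` with `Sub = Summit` (single-conjunct summit, D-0017)
set_option linter.dupNamespace false

noncomputable section

open CategoryTheory CategoryTheory.Limits AlgebraicGeometry TopologicalSpace
open Literature.AlgebraicGeometry.Resolution
open Scheme.IdealSheafData

namespace Summit.ResolutionOfSingularities.ResolutionOfSingularities.Theorems.DepthTargets

universe u

/-! ## The boundary of the booked list -/

section Boundary

variable {E' E'' : Scheme.{u}} {τ : E'' ⟶ E'} {C : E'.IdealSheafData}

/-- **The boundary of the list booked by `IsWeightedSeqJR.cons`** — strict transforms with the old exponents, then the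
exceptional member with exponent `e` — is the tree's transformed boundary `(boundaryOf ℬ').map st ++ [C𝒪_{E''}]` (BGMW
Def. 3.1.3 (4)). [cite: BierstoneGrigorievMilmanWlodarczyk2011, Def. 3.1.3 (4)] -/
theorem boundaryOf_map_strictTransform_append (ℬ' : List (E'.IdealSheafData × ℕ)) (e : ℕ) :
    boundaryOf ((ℬ'.map fun p => (strictTransformIdeal τ C p.1, p.2)) ++ [(C.comap τ, e)]) =
      (boundaryOf ℬ').map (strictTransformIdeal τ C) ++ [C.comap τ] := by
  simp only [boundaryOf, List.map_append, List.map_map, List.map_cons, List.map_nil, Function.comp_def]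

/-- **Hence the booked list's boundary has simple normal crossings** whenever the centre had simple normal crossings with the
old boundary (`HasSNCWith.hasSNC_transform`, Kollár Def. 3.25). [cite: Kollar2007, Def. 3.25]
[cite: BierstoneGrigorievMilmanWlodarczyk2011, Def. 3.1.3 (2), (4)] -/
theorem hasSNC_boundaryOf_map_strictTransform_append [IsLocallyNoetherian E'] {ℬ' : List (E'.IdealSheafData × ℕ)}
    (hsnc : HasSNCWith (boundaryOf ℬ') C) (hτ : IsBlowup τ C) (e : ℕ) :
    HasSNC (boundaryOf ((ℬ'.map fun p => (strictTransformIdeal τ C p.1, p.2)) ++ [(C.comap τ, e)])) := by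
  rw [boundaryOf_map_strictTransform_append]
  exact hsnc.hasSNC_transform hτ

end Boundary

/-! ## Along the sequence -/

/-- (i) **The two exponent lists keep the same underlying boundary**: if `𝒟.map Prod.fst = ℬ.map Prod.fst` at the start of
an `IsWeightedSeqJR` sequence then `𝒟'.map Prod.fst = ℬ'.map Prod.fst` at its end (each `cons` appends the strict
transforms in order and the same exceptional member to both lists). [cite: BierstoneGrigorievMilmanWlodarczyk2011, Def. 3.1.3 (4)] -/
theorem IsWeightedSeqJR.map_fst_eq {μ : ℕ} :
    ∀ {E' E : Scheme.{u}} {ρ : E' ⟶ E} {𝔟 D : E.IdealSheafData} {ℬ 𝒟 : List (E.IdealSheafData × ℕ)}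
      {𝔟' D' : E'.IdealSheafData} {ℬ' 𝒟' : List (E'.IdealSheafData × ℕ)},
      IsWeightedSeqJR μ ρ 𝔟 D ℬ 𝒟 𝔟' D' ℬ' 𝒟' → 𝒟.map Prod.fst = ℬ.map Prod.fst → 𝒟'.map Prod.fst = ℬ'.map Prod.fst
  | _, _, _, _, _, _, _, _, _, _, _, .nil 𝔟 D ℬ 𝒟 _ _, h0 => h0
  | _, _, _, _, _, _, _, _, _, _, _, .cons τ ρ 𝔟 D ℬ 𝒟 𝔟' D' ℬ' 𝒟' C ν m h _ _ _ _ _ _ _ _ _ _ _ _ _ _ _, h0 => by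
    have ih := h.map_fst_eq h0
    have key : ∀ L : List (_ × ℕ),
        (L.map fun p => (strictTransformIdeal τ C p.1, p.2)).map Prod.fst =
          (L.map Prod.fst).map (strictTransformIdeal τ C) := by
      intro L; simp only [List.map_map, Function.comp_def]
    simp only [List.map_append, List.map_cons, List.map_nil, key, ih]

/-- (i′) The same in `boundaryOf` spelling: `boundaryOf 𝒟 = boundaryOf ℬ → boundaryOf 𝒟' = boundaryOf ℬ'`. [folklore] -/
theorem IsWeightedSeqJR.boundaryOf_eq {μ : ℕ} {E' E : Scheme.{u}} {ρ : E' ⟶ E} {𝔟 D : E.IdealSheafData}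
    {ℬ 𝒟 : List (E.IdealSheafData × ℕ)} {𝔟' D' : E'.IdealSheafData} {ℬ' 𝒟' : List (E'.IdealSheafData × ℕ)}
    (h : IsWeightedSeqJR μ ρ 𝔟 D ℬ 𝒟 𝔟' D' ℬ' 𝒟') (h0 : boundaryOf 𝒟 = boundaryOf ℬ) :
    boundaryOf 𝒟' = boundaryOf ℬ' :=
  h.map_fst_eq h0

/-- (ii) **The carried host never acquires a boundary component**: at the end of any `IsWeightedSeqJR` sequence,
`∀ p ∈ ℬ', ¬ D' ≤ p.1` (by cases on the last constructor: the `nil` hypothesis, resp. the two «no boundary component»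
hypotheses of `cons` — for the strict transforms and for the new exceptional member). [folklore] -/
theorem IsWeightedSeqJR.not_le_boundary {μ : ℕ} :
    ∀ {E' E : Scheme.{u}} {ρ : E' ⟶ E} {𝔟 D : E.IdealSheafData} {ℬ 𝒟 : List (E.IdealSheafData × ℕ)}
      {𝔟' D' : E'.IdealSheafData} {ℬ' 𝒟' : List (E'.IdealSheafData × ℕ)},
      IsWeightedSeqJR μ ρ 𝔟 D ℬ 𝒟 𝔟' D' ℬ' 𝒟' → ∀ p ∈ ℬ', ¬ D' ≤ p.1
  | _, _, _, _, _, _, _, _, _, _, _, .nil 𝔟 D ℬ 𝒟 _ hnb => hnb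
  | _, _, _, _, _, _, _, _, _, _, _, .cons τ ρ 𝔟 D ℬ 𝒟 𝔟' D' ℬ' 𝒟' C ν m _ _ _ _ _ _ _ _ _ _ _ _ _ _ hnb hne => by
    intro p hp
    rcases List.mem_append.mp hp with hp | hp
    · obtain ⟨q, hq, rfl⟩ := List.mem_map.mp hp
      exact hnb q hq
    · rw [List.mem_singleton.mp hp]
      exact hne

/-- (iv) **The E-side invariant «state = carried host × boundary monomial» along the sequence**: over a locally Noetherian
`E`, at the end of any `IsWeightedSeqJR μ ρ 𝔟 D ℬ 𝒟 𝔟' D' ℬ' 𝒟'` the top `E'` is locally Noetherian and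
`𝔟' = D' · monomialIdeal ℬ'` (induction: the `nil` clause; at `cons`, part 1's one-step identity
`controlledTransform_host_mul_monomialIdeal` with exactly the `cons` hypotheses `D' ≤ C^m`, `ν ≤ m + w`,
`HasSNCWith (boundaryOf ℬ') C`, `UniformPieces ℬ' C [V(C)]`, `IsBlowup τ C`; local Noetherianity climbs along the proper,
finite-type blow-ups). [cite: BierstoneGrigorievMilmanWlodarczyk2011, Def. 3.1.3 (4), §3.2 Lemma 3.2.1, §4 Step 2a]
[cite: Kollar2007, (3.111) Steps 1–3] -/
theorem IsWeightedSeqJR.isLocallyNoetherian_and_eq {μ : ℕ} :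
    ∀ {E' E : Scheme.{u}} {ρ : E' ⟶ E} {𝔟 D : E.IdealSheafData} {ℬ 𝒟 : List (E.IdealSheafData × ℕ)}
      {𝔟' D' : E'.IdealSheafData} {ℬ' 𝒟' : List (E'.IdealSheafData × ℕ)},
      IsWeightedSeqJR μ ρ 𝔟 D ℬ 𝒟 𝔟' D' ℬ' 𝒟' → IsLocallyNoetherian E →
        IsLocallyNoetherian E' ∧ 𝔟' = D' * monomialIdeal ℬ'
  | _, _, _, _, _, _, _, _, _, _, _, .nil 𝔟 D ℬ 𝒟 h𝔟 _, hE => ⟨hE, h𝔟⟩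
  | _, _, _, _, _, _, _, _, _, _, _,
      .cons τ ρ 𝔟 D ℬ 𝒟 𝔟' D' ℬ' 𝒟' C ν m h _ _ _ _ _ hDm hsplit hsnc hU _ _ _ hτ _ _, hE => by
    obtain ⟨hE', h𝔟'⟩ := h.isLocallyNoetherian_and_eq hE
    haveI := hE'
    haveI : IsProper τ := hτ.isProper
    exact ⟨LocallyOfFiniteType.isLocallyNoetherian τ,
      controlledTransform_host_mul_monomialIdeal h𝔟' hDm hsplit hsnc hU hτ⟩

/-- (iv-a) The top of an `IsWeightedSeqJR` sequence over a locally Noetherian scheme is locally Noetherian. [folklore] -/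
theorem IsWeightedSeqJR.isLocallyNoetherian {μ : ℕ} {E' E : Scheme.{u}} {ρ : E' ⟶ E} {𝔟 D : E.IdealSheafData}
    {ℬ 𝒟 : List (E.IdealSheafData × ℕ)} {𝔟' D' : E'.IdealSheafData} {ℬ' 𝒟' : List (E'.IdealSheafData × ℕ)}
    (h : IsWeightedSeqJR μ ρ 𝔟 D ℬ 𝒟 𝔟' D' ℬ' 𝒟') [IsLocallyNoetherian E] : IsLocallyNoetherian E' :=
  (h.isLocallyNoetherian_and_eq inferInstance).1

/-- (iv-b) **`𝔟' = D' · monomialIdeal ℬ'` at the end of any `IsWeightedSeqJR` sequence over a locally Noetherian scheme** —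
the third conjunct of `DepthTargets.EndStateJR 𝔟' D' ℬ'`, for free. [cite: BierstoneGrigorievMilmanWlodarczyk2011, §4 Step 2a] -/
theorem IsWeightedSeqJR.eq_host_mul_monomialIdeal {μ : ℕ} {E' E : Scheme.{u}} {ρ : E' ⟶ E} {𝔟 D : E.IdealSheafData}
    {ℬ 𝒟 : List (E.IdealSheafData × ℕ)} {𝔟' D' : E'.IdealSheafData} {ℬ' 𝒟' : List (E'.IdealSheafData × ℕ)}
    (h : IsWeightedSeqJR μ ρ 𝔟 D ℬ 𝒟 𝔟' D' ℬ' 𝒟') [IsLocallyNoetherian E] : 𝔟' = D' * monomialIdeal ℬ' :=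
  (h.isLocallyNoetherian_and_eq inferInstance).2

/-- **The boundary of the `ℬ`-list has simple normal crossings at the end if it has at the start** (over a locally
Noetherian `E`; by cases: at `nil` the hypothesis, at `cons` the centre had simple normal crossings with the previous boundary
and `HasSNCWith.hasSNC_transform` applies to the booked list). [cite: Kollar2007, Def. 3.25]
[cite: BierstoneGrigorievMilmanWlodarczyk2011, Def. 3.1.3 (2), (4)] -/
theorem IsWeightedSeqJR.hasSNC_boundaryOf {μ : ℕ} :
    ∀ {E' E : Scheme.{u}} {ρ : E' ⟶ E} {𝔟 D : E.IdealSheafData} {ℬ 𝒟 : List (E.IdealSheafData × ℕ)}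
      {𝔟' D' : E'.IdealSheafData} {ℬ' 𝒟' : List (E'.IdealSheafData × ℕ)},
      IsWeightedSeqJR μ ρ 𝔟 D ℬ 𝒟 𝔟' D' ℬ' 𝒟' → IsLocallyNoetherian E → HasSNC (boundaryOf ℬ) → HasSNC (boundaryOf ℬ')
  | _, _, _, _, _, _, _, _, _, _, _, .nil 𝔟 D ℬ 𝒟 _ _, _, h0 => h0
  | _, _, _, _, _, _, _, _, _, _, _, .cons τ ρ 𝔟 D ℬ 𝒟 𝔟' D' ℬ' 𝒟' C ν m h _ _ _ _ _ _ _ hsnc _ _ _ _ hτ _ _, hE, _ => by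
    haveI := (h.isLocallyNoetherian_and_eq hE).1
    exact hasSNC_boundaryOf_map_strictTransform_append hsnc hτ _

/-- **Both lists' boundaries have simple normal crossings at the end** when they agree and are snc at the start
(`(i)` + `hasSNC_boundaryOf`). [cite: Kollar2007, Def. 3.25] -/
theorem IsWeightedSeqJR.hasSNC_boundaryOf_snd {μ : ℕ} {E' E : Scheme.{u}} {ρ : E' ⟶ E} {𝔟 D : E.IdealSheafData}
    {ℬ 𝒟 : List (E.IdealSheafData × ℕ)} {𝔟' D' : E'.IdealSheafData} {ℬ' 𝒟' : List (E'.IdealSheafData × ℕ)}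
    (h : IsWeightedSeqJR μ ρ 𝔟 D ℬ 𝒟 𝔟' D' ℬ' 𝒟') [IsLocallyNoetherian E] (h0 : boundaryOf 𝒟 = boundaryOf ℬ)
    (hsnc : HasSNC (boundaryOf ℬ)) : HasSNC (boundaryOf 𝒟') := by
  rw [h.boundaryOf_eq h0]
  exact h.hasSNC_boundaryOf inferInstance hsnc

/-- **`EndStateJR` from its two geometric clauses** (APPEND rev 2): along any `IsWeightedSeqJR` sequence over a locally Noetherian `E`,
the identity clause `𝔟' = D' · monomialIdeal ℬ'` of `DepthTargets.EndStateJR 𝔟' D' ℬ'` is automatic (`eq_host_mul_monomialIdeal`), so the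
producer (T5-E `weightTwoBoundaryJR₃_holds`) only owes «carried host regular» and «host :: boundary snc» at the end.
[cite: CossartJannsenSaito2020, Thm. 1.4] -/
theorem IsWeightedSeqJR.endStateJR_of {μ : ℕ} {E' E : Scheme.{u}} {ρ : E' ⟶ E} {𝔟 D : E.IdealSheafData}
    {ℬ 𝒟 : List (E.IdealSheafData × ℕ)} {𝔟' D' : E'.IdealSheafData} {ℬ' 𝒟' : List (E'.IdealSheafData × ℕ)}
    (h : IsWeightedSeqJR μ ρ 𝔟 D ℬ 𝒟 𝔟' D' ℬ' 𝒟') [IsLocallyNoetherian E] (hreg : Scheme.IsRegular D'.subscheme)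
    (hsnc : HasSNC (D' :: boundaryOf ℬ')) : EndStateJR 𝔟' D' ℬ' :=
  ⟨hreg, hsnc, h.eq_host_mul_monomialIdeal⟩

/-- **Empty initial boundary** (the T5-E start state `(𝔟, D = 𝔟, [], [])` of `WeightTwoBoundaryJR₃`): along any `IsWeightedSeqJR`
sequence starting with `ℬ = []` over a REGULAR locally Noetherian `E`, the boundary of the `ℬ`-list has simple normal crossings at the end
(`hasSNC_nil_of_isRegular` + `hasSNC_boundaryOf`). [cite: Kollar2007, Def. 3.25] -/
theorem IsWeightedSeqJR.hasSNC_boundaryOf_of_nil {μ : ℕ} {E' E : Scheme.{u}} {ρ : E' ⟶ E} {𝔟 D : E.IdealSheafData}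
    {𝒟 : List (E.IdealSheafData × ℕ)} {𝔟' D' : E'.IdealSheafData} {ℬ' 𝒟' : List (E'.IdealSheafData × ℕ)}
    (h : IsWeightedSeqJR μ ρ 𝔟 D [] 𝒟 𝔟' D' ℬ' 𝒟') [IsLocallyNoetherian E] (hE : Scheme.IsRegular E) :
    HasSNC (boundaryOf ℬ') :=
  h.hasSNC_boundaryOf inferInstance (by simpa only [boundaryOf, List.map_nil] using hasSNC_nil_of_isRegular hE)

/-- Both lists empty initially (`ℬ = 𝒟 = []`): the `𝒟`-list's boundary is snc at the end as well. [cite: Kollar2007, Def. 3.25] -/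
theorem IsWeightedSeqJR.hasSNC_boundaryOf_snd_of_nil {μ : ℕ} {E' E : Scheme.{u}} {ρ : E' ⟶ E} {𝔟 D : E.IdealSheafData}
    {𝔟' D' : E'.IdealSheafData} {ℬ' 𝒟' : List (E'.IdealSheafData × ℕ)}
    (h : IsWeightedSeqJR μ ρ 𝔟 D [] [] 𝔟' D' ℬ' 𝒟') [IsLocallyNoetherian E] (hE : Scheme.IsRegular E) :
    HasSNC (boundaryOf 𝒟') := by
  rw [h.boundaryOf_eq rfl]
  exact h.hasSNC_boundaryOf_of_nil hE

end Summit.ResolutionOfSingularities.ResolutionOfSingularities.Theorems.DepthTargets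

end
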